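import Summits.CriticalPhenomena.SAWScalingLimit.Theses.SAWRestrictionRigidity

/-!
# `SAWRestrictionRigidity.Assembly` (stmt-CriticalPhenomena-10487): the closing chain of the route

Closes the assembly item of route `SAWRestrictionRigidity` of the sub-problem `SAWScalingLimit`:

  `Assembly := Rigidity → AxiomsOfLimit → LimitExists → LSWRestrictionFact83 → SAWScalingLimit`.

This is literally the type of the route's deciding theorem
`Summit.CriticalPhenomena.SAWScalingLimit.Theses.SAWRestrictionRigidity.closes`, proved sorry-free
in the route file (rev 1): the full scaling limit `P` of the critical SAW laws comes from
`LimitExists`; `AxiomsOfLimit` gives restriction, the restriction-coupled Markov property,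
reversibility, lattice-similarity and conjugation covariance and simplicity of `P`; `Rigidity`
upgrades these to `IsConformallyCovariant`; `LSWRestrictionFact83` (LSW03 at `κ = 8/3`) identifies
each `P D` as the chordal SLE_{8/3} law; `integral_map` turns `TendstoLaw … id (P D)` into
`ConvergesInLawToSLE (8/3) D`, i.e. `SAWScalingLimit`. The proof below (`sawRestrictionRigidity_assembly_proof`)
unfolds `Assembly` and applies `closes`. No named fact is used; axioms are the standard three.

References: G. Lawler, O. Schramm, W. Werner, *Conformal restriction: the chordal case* (2003);
G. Lawler, O. Schramm, W. Werner, *On the scaling limit of planar self-avoiding walk* (2004).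
-/

namespace Summit.CriticalPhenomena.SAWScalingLimit.Theorems

/-- **Assembly of route SAWRestrictionRigidity** (item stmt-CriticalPhenomena-10487):
`Rigidity → AxiomsOfLimit → LimitExists → LSWRestrictionFact83 → SAWScalingLimit`, which is the
type of the route's deciding theorem `closes` (restriction–Markov rigidity gives conformal
covariance of the full SAW scaling limit, LSW03 at `κ = 8/3` identifies it as chordal SLE_{8/3},
and the change of variables `integral_map` gives convergence in law). [folklore] -/
theorem sawRestrictionRigidity_assembly_proof :
    Summit.CriticalPhenomena.SAWScalingLimit.Theses.SAWRestrictionRigidity.Assembly := by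
  unfold Summit.CriticalPhenomena.SAWScalingLimit.Theses.SAWRestrictionRigidity.Assembly
  intro hR hA hL h83
  exact Summit.CriticalPhenomena.SAWScalingLimit.Theses.SAWRestrictionRigidity.closes hR hA hL h83

end Summit.CriticalPhenomena.SAWScalingLimit.Theorems
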